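import Literature.MeasureTheory.Group.CoveringWeights
import Mathlib.MeasureTheory.Integral.DominatedConvergence
import HarnessLib

/-!
# Covering weights for Bochner integrals: exchange, independence of the weight and unfolding to a
# subgroup for integrable vector-valued functions

Topic `MeasureTheory/Group`; namespace `Literature.MeasureTheory.Group`. The Bochner companions of
the `[0, ∞]`-valued identities of `CoveringWeights` (Weil (1940), §9; Bourbaki, *Intégration* VII §2
no. 3–4), for a countable group `Γ` acting measurably on `(X, ν)` preserving `ν`, a `Γ`-invariant
strongly measurable `F : X → E` (Banach space) and `[0, ∞]`-valued weights `β` entering Bochner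
integrals through `wt β x = (β x).toReal`:

* `integral_wt_mul_coveringSum_smul_comm` — **the exchange identity**
  `∫ β₁ (Σ_γ β₂(γ•·)) • F dν = ∫ β₂ (Σ_γ β₁(γ•·)) • F dν` under `∫ ‖F‖ β₁ (Σ β₂) dν < ∞` (Fubini for
  series, `integral_tsum`, in place of Tonelli);
* `integral_wt_smul_eq_of_coveringSum_eq_one` — **independence of the weight**: for covering sums
  `≡ 1` and `∫ ‖F‖ β₁ < ∞`, `∫ β₁ • F = ∫ β₂ • F` (`lintegral_enorm_mul_eq_of_coveringSum_eq_one`: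
  the `L¹` condition transfers);
* `integral_wt_smul_eq_integral_wt_smul_tsum` — **unfolding to a subgroup** `Γ' ≤ Γ ≤ G`: for `F`
  `Γ'`-invariant with `∫ ‖F‖ β' < ∞`, a `Γ'`-weight `β'`, a `Γ`-weight `β` and representatives `s i`
  of `Γ'\Γ`, `∫ β' • F dν = ∫ β • (Σ_i F(s i • ·)) dν`, the inner series converging absolutely a.e.
  where `β ≠ 0`.

These are the tools for unfolding *signed* (complex) integrals — e.g. of a cusp form against a sum
over a `GL_n(K)`-orbit — where cancellation, not positivity, is the point. Everything is proved.

## References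

* A. Weil, *L'intégration dans les groupes topologiques et ses applications* (1940), §9.
* N. Bourbaki, *Intégration*, Ch. VII, §2, no. 3–4.
* J. W. Cogdell, *Analytic theory of L-functions for GL_n* (2004), §2.3 [CogdellAnalyticTheory2004].
-/

noncomputable section

open _root_.MeasureTheory _root_.MeasureTheory.Measure Set Filter Function
open scoped ENNReal NNReal Pointwise

namespace Literature.MeasureTheory.Group

section Exchange

variable {Γ : Type*} [Group Γ] {X : Type*} [MulAction Γ X] [MeasurableSpace X]
  [MeasurableConstSMul Γ X] [Countable Γ] (ν : Measure X) [SMulInvariantMeasure Γ X ν]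
  {E : Type*} [NormedAddCommGroup E] [NormedSpace ℝ E]

/-- The real weight attached to `β : X → [0, ∞]` (finite values are meant). [folklore] -/
abbrev wt (β : X → ℝ≥0∞) (x : X) : ℝ := (β x).toReal

omit [MeasurableSpace X] [MeasurableConstSMul Γ X] [Countable Γ] in
/-- A weight with finite covering sums is finite everywhere. [folklore] -/
theorem lt_top_of_coveringSum_ne_top {β : X → ℝ≥0∞} {x : X} (h : coveringSum Γ β x ≠ ∞) (γ : Γ) :
    β (γ • x) < ∞ :=
  lt_of_le_of_lt (ENNReal.le_tsum γ) (lt_top_iff_ne_top.2 h)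

/-- **The exchange identity for Bochner integrals.** For a countable group `Γ` acting measurably on
`(X, ν)` preserving `ν`, a `Γ`-invariant strongly measurable `F : X → E`, measurable weights
`β₁, β₂ : X → [0, ∞]` with finite covering sums, and
`∫ ‖F‖ β₁ (Σ_γ β₂(γ•·)) dν < ∞`:
`∫ β₁ (Σ_γ β₂(γ•·)) • F dν = ∫ β₂ (Σ_γ β₁(γ•·)) • F dν` (as `lintegral_mul_mul_coveringSum_comm`,
with Fubini for series, `integral_tsum_of_summable_integral_norm`, in place of Tonelli).
[folklore] -/
theorem integral_wt_mul_coveringSum_smul_comm {F : X → E} (hFm : StronglyMeasurable F)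
    (hFinv : ∀ (γ : Γ) (x : X), F (γ • x) = F x) {β₁ β₂ : X → ℝ≥0∞} (hβ₁ : Measurable β₁) (hβ₂ : Measurable β₂)
    (h₁ : ∀ x, coveringSum Γ β₁ x ≠ ∞) (h₂ : ∀ x, coveringSum Γ β₂ x ≠ ∞)
    (hint : ∫⁻ x, ‖F x‖ₑ * β₁ x * coveringSum Γ β₂ x ∂ν < ∞) :
    ∫ x, (wt β₁ x * wt (coveringSum Γ β₂) x) • F x ∂ν =
      ∫ x, (wt β₂ x * wt (coveringSum Γ β₁) x) • F x ∂ν := by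
  have hint' : ∫⁻ x, ‖F x‖ₑ * β₂ x * coveringSum Γ β₁ x ∂ν < ∞ := by
    rw [← lintegral_mul_mul_coveringSum_comm ν hFm.enorm (fun γ x => show ‖F (γ • x)‖ₑ = ‖F x‖ₑ by rw [hFinv]) hβ₁ hβ₂]
    exact hint
  -- the terms of the two series
  set f₁ : Γ → X → E := fun γ x => (wt β₁ x * wt β₂ (γ • x)) • F x with hf₁
  set f₂ : Γ → X → E := fun γ x => (wt β₁ (γ • x) * wt β₂ x) • F x with hf₂
  have hm₁ : ∀ γ, AEStronglyMeasurable (f₁ γ) ν := fun γ =>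
    ((hβ₁.ennreal_toReal.mul (hβ₂.ennreal_toReal.comp (measurable_const_smul γ))).aestronglyMeasurable).smul
      hFm.aestronglyMeasurable
  have hm₂ : ∀ γ, AEStronglyMeasurable (f₂ γ) ν := fun γ =>
    (((hβ₁.ennreal_toReal.comp (measurable_const_smul γ)).mul hβ₂.ennreal_toReal).aestronglyMeasurable).smul
      hFm.aestronglyMeasurable
  -- norms of the terms
  have hn₁ : ∀ γ x, ‖f₁ γ x‖ₑ = ‖F x‖ₑ * β₁ x * β₂ (γ • x) := by
    intro γ x
    have hb₁ : β₁ x ≠ ∞ := by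
      have h := lt_top_of_coveringSum_ne_top (h₁ x) (1 : Γ)
      rw [one_smul] at h
      exact h.ne
    have hb₂ : β₂ (γ • x) ≠ ∞ := (lt_top_of_coveringSum_ne_top (h₂ x) γ).ne
    rw [hf₁]
    simp only [wt, enorm_smul, enorm_mul, Real.enorm_eq_ofReal ENNReal.toReal_nonneg,
      ENNReal.ofReal_toReal hb₁, ENNReal.ofReal_toReal hb₂]
    ring
  have hn₂ : ∀ γ x, ‖f₂ γ x‖ₑ = ‖F x‖ₑ * β₁ (γ • x) * β₂ x := by
    intro γ x
    have hb₁ : β₁ (γ • x) ≠ ∞ := (lt_top_of_coveringSum_ne_top (h₁ x) γ).ne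
    have hb₂ : β₂ x ≠ ∞ := by
      have h := lt_top_of_coveringSum_ne_top (h₂ x) (1 : Γ)
      rw [one_smul] at h
      exact h.ne
    rw [hf₂]
    simp only [wt, enorm_smul, enorm_mul, Real.enorm_eq_ofReal ENNReal.toReal_nonneg,
      ENNReal.ofReal_toReal hb₁, ENNReal.ofReal_toReal hb₂]
    ring
  -- summability of the `L¹` norms
  have hS₁ : ∑' γ, ∫⁻ x, ‖f₁ γ x‖ₑ ∂ν ≠ ∞ := by
    simp_rw [hn₁]
    have hmk : ∀ γ : Γ, AEMeasurable (fun x => ‖F x‖ₑ * β₁ x * β₂ (γ • x)) ν := fun γ =>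
      ((hFm.enorm.mul hβ₁).mul (hβ₂.comp (measurable_const_smul γ))).aemeasurable
    rw [← lintegral_tsum hmk]
    have : ∫⁻ x, ∑' γ : Γ, ‖F x‖ₑ * β₁ x * β₂ (γ • x) ∂ν = ∫⁻ x, ‖F x‖ₑ * β₁ x * coveringSum Γ β₂ x ∂ν := by
      refine lintegral_congr fun x => ?_
      rw [coveringSum_apply, ← ENNReal.tsum_mul_left]
    rw [this]
    exact hint.ne
  have hS₂ : ∑' γ, ∫⁻ x, ‖f₂ γ x‖ₑ ∂ν ≠ ∞ := by
    simp_rw [hn₂]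
    have hmk : ∀ γ : Γ, AEMeasurable (fun x => ‖F x‖ₑ * β₁ (γ • x) * β₂ x) ν := fun γ =>
      ((hFm.enorm.mul (hβ₁.comp (measurable_const_smul γ))).mul hβ₂).aemeasurable
    rw [← lintegral_tsum hmk]
    have : ∫⁻ x, ∑' γ : Γ, ‖F x‖ₑ * β₁ (γ • x) * β₂ x ∂ν = ∫⁻ x, ‖F x‖ₑ * β₂ x * coveringSum Γ β₁ x ∂ν := by
      refine lintegral_congr fun x => ?_
      rw [coveringSum_apply, ← ENNReal.tsum_mul_left]
      refine tsum_congr fun γ => ?_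
      ring
    rw [this]
    exact hint'.ne
  -- pointwise: the series of the terms
  have hws : ∀ {β : X → ℝ≥0∞}, (∀ x, coveringSum Γ β x ≠ ∞) → ∀ x,
      wt (coveringSum Γ β) x = ∑' γ : Γ, wt β (γ • x) := fun {β} h x => by
    simp only [wt, coveringSum_apply]
    exact ENNReal.tsum_toReal_eq fun γ => (lt_top_of_coveringSum_ne_top (h x) γ).ne
  have hsum : ∀ {β : X → ℝ≥0∞}, (∀ x, coveringSum Γ β x ≠ ∞) → ∀ x,
      Summable fun γ : Γ => wt β (γ • x) := fun {β} h x =>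
    ENNReal.summable_toReal (by rw [← coveringSum_apply]; exact h x)
  have hp₁ : ∀ x, (wt β₁ x * wt (coveringSum Γ β₂) x) • F x = ∑' γ, f₁ γ x := by
    intro x
    simp only [hf₁, hws h₂ x, ← tsum_mul_left]
    exact (((hsum h₂ x).mul_left (wt β₁ x)).tsum_smul_const (F x)).symm
  have hp₂ : ∀ x, (wt β₂ x * wt (coveringSum Γ β₁) x) • F x = ∑' γ, f₂ γ x := by
    intro x
    simp only [hf₂, hws h₁ x, ← tsum_mul_left]
    have h := (((hsum h₁ x).mul_left (wt β₂ x)).tsum_smul_const (F x)).symm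
    refine h.trans (tsum_congr fun γ => ?_)
    rw [mul_comm]
  -- the chain
  calc ∫ x, (wt β₁ x * wt (coveringSum Γ β₂) x) • F x ∂ν
      = ∫ x, ∑' γ, f₁ γ x ∂ν := integral_congr_ae (Eventually.of_forall hp₁)
    _ = ∑' γ, ∫ x, f₁ γ x ∂ν := integral_tsum hm₁ hS₁
    _ = ∑' γ, ∫ x, f₂ γ⁻¹ x ∂ν := by
        refine tsum_congr fun γ => ?_
        have h := (measurePreserving_smul γ⁻¹ ν).integral_comp (measurableEmbedding_const_smul γ⁻¹) (f₁ γ)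
        rw [← h]
        refine integral_congr_ae (Eventually.of_forall fun x => ?_)
        simp only [hf₁, hf₂, smul_inv_smul, hFinv]
    _ = ∑' γ, ∫ x, f₂ γ x ∂ν := (Equiv.inv Γ).tsum_eq fun γ => ∫ x, f₂ γ x ∂ν
    _ = ∫ x, ∑' γ, f₂ γ x ∂ν := (integral_tsum hm₂ hS₂).symm
    _ = ∫ x, (wt β₂ x * wt (coveringSum Γ β₁) x) • F x ∂ν := integral_congr_ae (Eventually.of_forall fun x => (hp₂ x).symm)

/-- **Independence of the weight for Bochner integrals.** If `β₁, β₂` have covering sums `≡ 1` and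
`∫ ‖F‖ β₁ dν < ∞` for a `Γ`-invariant strongly measurable `F`, then `∫ β₁ • F dν = ∫ β₂ • F dν`
(and `∫ ‖F‖ β₂ dν = ∫ ‖F‖ β₁ dν < ∞`). [folklore] -/
theorem integral_wt_smul_eq_of_coveringSum_eq_one {F : X → E} (hFm : StronglyMeasurable F)
    (hFinv : ∀ (γ : Γ) (x : X), F (γ • x) = F x) {β₁ β₂ : X → ℝ≥0∞} (hβ₁ : Measurable β₁) (hβ₂ : Measurable β₂)
    (h₁ : ∀ x, coveringSum Γ β₁ x = 1) (h₂ : ∀ x, coveringSum Γ β₂ x = 1)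
    (hint : ∫⁻ x, ‖F x‖ₑ * β₁ x ∂ν < ∞) :
    ∫ x, wt β₁ x • F x ∂ν = ∫ x, wt β₂ x • F x ∂ν := by
  have key := integral_wt_mul_coveringSum_smul_comm ν hFm hFinv hβ₁ hβ₂
    (fun x => by rw [h₁ x]; exact ENNReal.one_ne_top) (fun x => by rw [h₂ x]; exact ENNReal.one_ne_top)
    (by simp_rw [h₂, mul_one]; exact hint)
  have e : ∀ x, wt (coveringSum Γ β₂) x = 1 := fun x => by simp [wt, h₂ x]
  have e' : ∀ x, wt (coveringSum Γ β₁) x = 1 := fun x => by simp [wt, h₁ x]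
  simp only [e, e', mul_one] at key
  exact key

omit [NormedSpace ℝ E] in
/-- The `L¹` condition transfers between weights of covering sum one. [folklore] -/
theorem lintegral_enorm_mul_eq_of_coveringSum_eq_one {F : X → E} (hFm : StronglyMeasurable F)
    (hFinv : ∀ (γ : Γ) (x : X), F (γ • x) = F x) {β₁ β₂ : X → ℝ≥0∞} (hβ₁ : Measurable β₁) (hβ₂ : Measurable β₂)
    (h₁ : ∀ x, coveringSum Γ β₁ x = 1) (h₂ : ∀ x, coveringSum Γ β₂ x = 1) :
    ∫⁻ x, ‖F x‖ₑ * β₁ x ∂ν = ∫⁻ x, ‖F x‖ₑ * β₂ x ∂ν :=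
  lintegral_mul_eq_of_coveringSum_eq ν hFm.enorm (fun γ x => show ‖F (γ • x)‖ₑ = ‖F x‖ₑ by rw [hFinv]) hβ₁ hβ₂
    one_ne_zero ENNReal.one_ne_top h₁ h₂

end Exchange

/-! ### Unfolding to a subgroup for Bochner integrals -/

section Unfolding

variable {G : Type*} [Group G] {X : Type*} [MulAction G X] [MeasurableSpace X]
  [MeasurableConstSMul G X] (ν : Measure X) [SMulInvariantMeasure G X ν]
  (Γ Γ' : Subgroup G)
  {E : Type*} [NormedAddCommGroup E] [NormedSpace ℝ E]

/-- **Unfolding to a subgroup, Bochner version.** Let `Γ' ≤ Γ ≤ G` with `Γ` countable, `G` acting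
measurably on `(X, ν)` preserving `ν`; `F : X → E` strongly measurable and `Γ'`-invariant with
`∫ ‖F‖ β' dν < ∞`, `β'` a `Γ'`-weight and `β` a `Γ`-weight of covering sums `1`, and `s i ∈ Γ`
representatives of the right cosets `Γ'\Γ`. Then the series `Σ_i F(s i • x)` converges absolutely for
a.e. `x` with `β x ≠ 0`, and
`∫ β' • F dν = ∫ β • (Σ_i F(s i • ·)) dν`
(as `lintegral_mul_eq_lintegral_tsum_mul`, with Fubini for series). [cite: CogdellAnalyticTheory2004, §2.3] -/
theorem integral_wt_smul_eq_integral_wt_smul_tsum [CompleteSpace E] [Countable Γ] (hle : Γ' ≤ Γ) {F : X → E}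
    (hFm : StronglyMeasurable F) (hFinv : ∀ γ ∈ Γ', ∀ x : X, F (γ • x) = F x)
    {β' β : X → ℝ≥0∞} (hβ' : Measurable β') (hβ'w : ∀ x, coveringSum Γ' β' x = 1)
    (hβ : Measurable β) (hβw : ∀ x, coveringSum Γ β x = 1)
    {ι : Type*} [Countable ι] {s : ι → G} (hsΓ : ∀ i, s i ∈ Γ)
    (hs : ∀ γ ∈ Γ, ∃! i, γ * (s i)⁻¹ ∈ Γ')
    (hint : ∫⁻ x, ‖F x‖ₑ * β' x ∂ν < ∞) :
    ∫ x, wt β' x • F x ∂ν = ∫ x, wt β x • (∑' i, F (s i • x)) ∂ν := by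
  haveI : Countable Γ' := (Subgroup.inclusion_injective hle).countable
  have hFinv' : ∀ (γ : Γ') (x : X), F (γ • x) = F x := fun γ x => hFinv γ γ.2 x
  -- Step 1: replace `β'` by the unfolded weight (independence of the weight for `Γ'`)
  have hw : ∀ x, coveringSum Γ' (unfoldWeight β s) x = 1 := fun x => by
    rw [coveringSum_unfoldWeight Γ Γ' hle β hsΓ hs x, hβw x]
  have huw : Measurable (unfoldWeight β s) := measurable_unfoldWeight hβ s
  have step1 : ∫ x, wt β' x • F x ∂ν = ∫ x, wt (unfoldWeight β s) x • F x ∂ν :=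
    integral_wt_smul_eq_of_coveringSum_eq_one ν hFm hFinv' hβ' huw hβ'w hw hint
  have hint2 : ∫⁻ x, ‖F x‖ₑ * unfoldWeight β s x ∂ν < ∞ := by
    rw [← lintegral_enorm_mul_eq_of_coveringSum_eq_one ν hFm hFinv' hβ' huw hβ'w hw]; exact hint
  rw [step1]
  -- finiteness of the weights
  have hβfin : ∀ x, β x ≠ ∞ := fun x => by
    have h := lt_top_of_coveringSum_ne_top (Γ := Γ) (by rw [hβw x]; exact ENNReal.one_ne_top) (1 : Γ)
    rw [one_smul] at h; exact h.ne
  have huwfin : ∀ x i, β ((s i)⁻¹ • x) ≠ ∞ := fun x i => hβfin _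
  -- the terms of the two series
  set g₁ : ι → X → E := fun i x => wt β ((s i)⁻¹ • x) • F x with hg₁
  set g₂ : ι → X → E := fun i x => wt β x • F (s i • x) with hg₂
  have hm₁ : ∀ i, AEStronglyMeasurable (g₁ i) ν := fun i =>
    ((hβ.ennreal_toReal.comp (measurable_const_smul (s i)⁻¹)).aestronglyMeasurable).smul hFm.aestronglyMeasurable
  have hm₂ : ∀ i, AEStronglyMeasurable (g₂ i) ν := fun i =>
    (hβ.ennreal_toReal.aestronglyMeasurable).smul (hFm.comp_measurable (measurable_const_smul (s i))).aestronglyMeasurable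
  have hn₁ : ∀ i x, ‖g₁ i x‖ₑ = ‖F x‖ₑ * β ((s i)⁻¹ • x) := by
    intro i x
    rw [hg₁]
    simp only [wt, enorm_smul, Real.enorm_eq_ofReal ENNReal.toReal_nonneg, ENNReal.ofReal_toReal (huwfin x i)]
    ring
  have hn₂ : ∀ i x, ‖g₂ i x‖ₑ = ‖F (s i • x)‖ₑ * β x := by
    intro i x
    rw [hg₂]
    simp only [wt, enorm_smul, Real.enorm_eq_ofReal ENNReal.toReal_nonneg, ENNReal.ofReal_toReal (hβfin x)]
    ring
  have hmk₁ : ∀ i, AEMeasurable (fun x => ‖F x‖ₑ * β ((s i)⁻¹ • x)) ν := fun i =>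
    (hFm.enorm.mul (hβ.comp (measurable_const_smul (s i)⁻¹))).aemeasurable
  have hmk₂ : ∀ i, AEMeasurable (fun x => ‖F (s i • x)‖ₑ * β x) ν := fun i =>
    ((hFm.enorm.comp (measurable_const_smul (s i))).mul hβ).aemeasurable
  have hS₁ : ∑' i, ∫⁻ x, ‖g₁ i x‖ₑ ∂ν ≠ ∞ := by
    simp_rw [hn₁]
    rw [← lintegral_tsum hmk₁]
    have : ∫⁻ x, ∑' i, ‖F x‖ₑ * β ((s i)⁻¹ • x) ∂ν = ∫⁻ x, ‖F x‖ₑ * unfoldWeight β s x ∂ν := by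
      refine lintegral_congr fun x => ?_
      rw [unfoldWeight, ENNReal.tsum_mul_left]
    rw [this]
    exact hint2.ne
  have hsub : ∀ i, ∫⁻ x, ‖F (s i • x)‖ₑ * β x ∂ν = ∫⁻ x, ‖F x‖ₑ * β ((s i)⁻¹ • x) ∂ν := by
    intro i
    have hmi : Measurable fun x => ‖F x‖ₑ * β ((s i)⁻¹ • x) :=
      hFm.enorm.mul (hβ.comp (measurable_const_smul (s i)⁻¹))
    have h := (measurePreserving_smul (s i) ν).lintegral_comp hmi
    rw [← h]
    refine lintegral_congr fun x => ?_
    simp only [inv_smul_smul]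
  have hS₂ : ∑' i, ∫⁻ x, ‖g₂ i x‖ₑ ∂ν ≠ ∞ := by
    simp_rw [hn₂, hsub]
    rw [← lintegral_tsum hmk₁]
    have : ∫⁻ x, ∑' i, ‖F x‖ₑ * β ((s i)⁻¹ • x) ∂ν = ∫⁻ x, ‖F x‖ₑ * unfoldWeight β s x ∂ν := by
      refine lintegral_congr fun x => ?_
      rw [unfoldWeight, ENNReal.tsum_mul_left]
    rw [this]
    exact hint2.ne
  -- a.e. absolute convergence of `Σ_i F(s i • x)` where `β x ≠ 0`
  have hfin : ∀ᵐ x ∂ν, (∑' i, ‖F (s i • x)‖ₑ) * β x < ∞ := by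
    have hlt : ∫⁻ x, (∑' i, ‖F (s i • x)‖ₑ) * β x ∂ν < ∞ := by
      have e : ∫⁻ x, (∑' i, ‖F (s i • x)‖ₑ) * β x ∂ν = ∑' i, ∫⁻ x, ‖F (s i • x)‖ₑ * β x ∂ν := by
        rw [← lintegral_tsum hmk₂]
        refine lintegral_congr fun x => ?_
        rw [ENNReal.tsum_mul_right]
      rw [e]
      simp_rw [← hn₂]
      exact lt_top_iff_ne_top.2 hS₂
    exact ae_lt_top' ((AEMeasurable.tsum fun i => (hFm.enorm.comp (measurable_const_smul (s i))).aemeasurable).mul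
      hβ.aemeasurable) hlt.ne
  -- pointwise identities
  have hp₁ : ∀ x, wt (unfoldWeight β s) x • F x = ∑' i, g₁ i x := by
    intro x
    rw [hg₁]
    simp only [wt, unfoldWeight]
    rw [ENNReal.tsum_toReal_eq (huwfin x)]
    exact ((ENNReal.summable_toReal (by
      have h1 := hw x
      rw [coveringSum_apply] at h1
      have : unfoldWeight β s x ≤ 1 := by
        calc unfoldWeight β s x = unfoldWeight β s ((1 : Γ') • x) := by rw [one_smul]
          _ ≤ ∑' γ : Γ', unfoldWeight β s (γ • x) := ENNReal.le_tsum (1 : Γ')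
          _ = 1 := h1
      exact (lt_of_le_of_lt this ENNReal.one_lt_top).ne)).tsum_smul_const (F x)).symm
  have hp₂ : ∀ᵐ x ∂ν, wt β x • (∑' i, F (s i • x)) = ∑' i, g₂ i x := by
    filter_upwards [hfin] with x hx
    rw [hg₂]
    simp only []
    by_cases hb : β x = 0
    · simp only [wt, hb, ENNReal.toReal_zero, zero_smul, tsum_zero]
    · have hsum : Summable fun i => F (s i • x) := by
        refine .of_norm ?_
        have hne : (∑' i, ‖F (s i • x)‖ₑ) ≠ ∞ := by
          intro htop
          rw [htop, ENNReal.top_mul hb] at hx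
          exact lt_irrefl _ hx
        have := ENNReal.summable_toReal hne
        simpa [enorm, ENNReal.toReal] using this
      exact (hsum.tsum_const_smul (wt β x)).symm
  calc ∫ x, wt (unfoldWeight β s) x • F x ∂ν
      = ∫ x, ∑' i, g₁ i x ∂ν := integral_congr_ae (Eventually.of_forall hp₁)
    _ = ∑' i, ∫ x, g₁ i x ∂ν := integral_tsum hm₁ hS₁
    _ = ∑' i, ∫ x, g₂ i x ∂ν := by
        refine tsum_congr fun i => ?_
        have h := (measurePreserving_smul (s i) ν).integral_comp (measurableEmbedding_const_smul (s i)) (g₁ i)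
        rw [← h]
        refine integral_congr_ae (Eventually.of_forall fun x => ?_)
        simp only [hg₁, hg₂, inv_smul_smul]
    _ = ∫ x, ∑' i, g₂ i x ∂ν := (integral_tsum hm₂ hS₂).symm
    _ = ∫ x, wt β x • (∑' i, F (s i • x)) ∂ν := integral_congr_ae (hp₂.mono fun x hx => hx.symm)

end Unfolding

end Literature.MeasureTheory.Group
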